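import Literature.NumberTheory.Automorphic.SmoothedVectorTranslation
import Literature.NumberTheory.Automorphic.TestFunctionGLArchSlice
import Literature.Analysis.Calculus.SmoothKernelIntegral
import HarnessLib

/-!
# Translates and archimedean unipotent convolutions of test functions are test functions

Topic `NumberTheory/Automorphic`; namespace `Literature.NumberTheory.Automorphic`. Proof file
(theorems only). For the test functions `IsTestFunctionGL n K η` on `GL_n(𝔸_K)` (continuous,
compactly supported, smooth in the archimedean variable, right invariant under an admissible level)
we PROVE:

* `isTestFunctionGL_of_contDiff_expSlice` — a criterion: it suffices that the right exponential
  slices `M ↦ η(g · (exp M, 1))` are `C^∞` on `M_n(K_∞)` (the converse of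
  `IsTestFunctionGL.contDiff_expSlice`);
* `IsTestFunctionGL.leftTranslate` — **left translates `L_h η = η(h⁻¹ ·)` of test functions are test
  functions** (`leftTranslateWeight` of `SmoothedVectorTranslation`);
* `isTestFunctionGL_archUnipotentConv` — **the archimedean unipotent convolution
  `(g₀ ⋆ η)(h) = ∫_{K_∞} g₀(x) η(n((x,0))⁻¹ h) dx` of a test function on `GL_2(𝔸_K)` by a `C^∞`
  compactly supported kernel `g₀` on `K_∞` is a test function** (`archUnipotentConv`): smoothness of
  the exponential slices by differentiation under the integral sign
  (`Literature.Analysis.Calculus.contDiff_integral_kernel_mul`), the integrand being the smooth left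
  archimedean slice `leftArchSlice η g` (`IsTestFunctionGL.contDiff_leftArchSlice`) evaluated at
  the smooth matrix `n(-x) · g_∞ exp(M) g_∞⁻¹`; and left invariance under `(1, U₀)` is inherited
  (`archUnipotentConv_ofFinite_mul`).

These are the "smooth vector" inputs of the commutation calculus for the Kirillov `L²`-bound
(Jacquet–Shalika (1981), §3–§4; Bump (1997), Prop. 2.2.3–(2.28): `π(f)` preserves `C_c^∞`-smoothed
vectors).

## References

* H. Jacquet, J. A. Shalika, *On Euler products and the classification of automorphic
  representations I*, Amer. J. Math. 103 (1981), §3–§4 [JacquetShalikaAJM1981].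
* D. Bump, *Automorphic Forms and Representations* (1997), §2.2 [Bump1997].
-/

noncomputable section

open scoped MatrixGroups Classical ContDiff
open NumberField NumberField.mixedEmbedding IsDedekindDomain MeasureTheory Complex

namespace Literature.NumberTheory.Automorphic

variable {n : ℕ} {K : Type} [Field K] [NumberField K]

-- the ring structure on matrices is only reducibly-defeq to the Pi uniformity (see
-- `TestFunctionGLArchSlice`); the operator norm is the one `IsArchSmooth` is stated with.
set_option backward.isDefEq.respectTransparency false

attribute [local instance 100] LieRing.ofAssociativeRing

/-- `M_n(K_∞)` is finite-dimensional over `ℝ` (a local instance, cf.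
`finiteDimensional_matrix_mixedSpace` of `GLnCuspidalSpectrumSiegelProofs`). [folklore] -/
private theorem finiteDimensional_matrix_mixedSpace' : FiniteDimensional ℝ (Matrix (Fin n) (Fin n) (mixedSpace K)) :=
  Module.Finite.matrix

attribute [local instance] finiteDimensional_matrix_mixedSpace'

open scoped Matrix.Norms.Operator

/-! ### A criterion and left translates -/

/-- **Criterion for test functions**: continuity, compact support, smoothness of the right
exponential slices `M ↦ η(g (exp M, 1))` on `M_n(K_∞)`, and right invariance under an admissible
level. [folklore] -/
theorem isTestFunctionGL_of_contDiff_expSlice {η : GL (Fin n) (AdeleRing (𝓞 K) K) → ℝ}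
    (hc : Continuous η) (hs : HasCompactSupport η)
    (hsm : ∀ g : GL (Fin n) (AdeleRing (𝓞 K) K),
      ContDiff ℝ ∞ fun M : Matrix (Fin n) (Fin n) (mixedSpace K) => η (g * GLn.ofInfinite n K (expGL M)))
    (hU : ∃ U ∈ finiteLevelsGL n K, ∀ u ∈ U, ∀ g, η (g * u) = η g) :
    IsTestFunctionGL n K η := by
  refine ⟨hc, hs, ?_, hU⟩
  intro (g : GL (Fin n) (AdeleRing (𝓞 K) K))
  show ContDiff ℝ ∞ fun X : (archGroupGL n K).lie.toSubmodule =>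
    ((η ((g : GL (Fin n) (AdeleRing (𝓞 K) K)) *
      GLn.ofInfinite n K (expGL (X : Matrix (Fin n) (Fin n) (mixedSpace K)))) : ℝ) : ℂ)
  exact Complex.ofRealCLM.contDiff.comp
    ((hsm g).comp ((archGroupGL n K).lie.toSubmodule.subtypeL.contDiff))

/-- **Left translates of test functions are test functions.** [folklore] -/
theorem IsTestFunctionGL.leftTranslate {η : GL (Fin n) (AdeleRing (𝓞 K) K) → ℝ} (hη : IsTestFunctionGL n K η)
    (h : GL (Fin n) (AdeleRing (𝓞 K) K)) :
    IsTestFunctionGL n K (leftTranslateWeight (n := n) h η) := by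
  refine isTestFunctionGL_of_contDiff_expSlice (continuous_leftTranslateWeight hη.continuous h)
    (hasCompactSupport_leftTranslateWeight hη.hasCompactSupport h) (fun g => ?_) ?_
  · have h1 := hη.contDiff_expSlice (h⁻¹ * g)
    simp only [mul_assoc] at h1
    exact h1
  · obtain ⟨U, hU, hinv⟩ := hη.exists_level
    refine ⟨U, hU, fun u hu g => ?_⟩
    rw [leftTranslateWeight_apply, leftTranslateWeight_apply, ← mul_assoc, hinv u hu]

/-! ### The archimedean unipotent convolution on `GL_2` -/

section GL2

variable {η : GL (Fin 2) (AdeleRing (𝓞 K) K) → ℝ}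

variable (K) in
/-- `n((x, 0)) ∈ GL_2(𝔸_K)`, `GL`-typed (reducibly `archUnipotentAdelic K x`). [folklore] -/
abbrev archUnipotentGL (x : mixedSpace K) : GL (Fin 2) (AdeleRing (𝓞 K) K) := archUnipotentAdelic K x

/-- `archUnipotentGL K x = GLn.ofInfinite 2 K (n(x))`. [folklore] -/
theorem archUnipotentGL_eq (x : mixedSpace K) :
    archUnipotentGL K x = GLn.ofInfinite 2 K ((unipotentGL2 x : ↥(upperUnitriangular (Fin 2) (mixedSpace K))) :
      GL (Fin 2) (mixedSpace K)) :=
  (ofInfinite_unipotentGL2 x).symm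

/-- Unfolding of the convolution at a `GL`-typed argument. [folklore] -/
theorem archUnipotentConv_apply_gl (g₀ : mixedSpace K → ℝ) (g : GL (Fin 2) (AdeleRing (𝓞 K) K)) :
    archUnipotentConv g₀ η g = ∫ x, g₀ x * η ((archUnipotentGL K x)⁻¹ * g) := rfl

/-- Right invariance is inherited by the convolution. [folklore] -/
theorem archUnipotentConv_mul_right {U : Set (GL (Fin 2) (AdeleRing (𝓞 K) K))}
    (hinv : ∀ u ∈ U, ∀ g, η (g * u) = η g) (g₀ : mixedSpace K → ℝ) (u : GL (Fin 2) (AdeleRing (𝓞 K) K))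
    (hu : u ∈ U) (g : GL (Fin 2) (AdeleRing (𝓞 K) K)) :
    archUnipotentConv g₀ η (g * u) = archUnipotentConv g₀ η g := by
  rw [archUnipotentConv_apply_gl, archUnipotentConv_apply_gl]
  refine integral_congr_ae (ae_of_all _ fun x => ?_)
  show g₀ x * η ((archUnipotentGL K x)⁻¹ * (g * u)) = g₀ x * η ((archUnipotentGL K x)⁻¹ * g)
  rw [← mul_assoc, hinv u hu]

/-- **Left invariance under `(1, U₀)` is inherited by the convolution** (the archimedean unipotents
commute with `GL_n(𝔸_f)`). [folklore] -/
theorem archUnipotentConv_ofFinite_mul {U₀ : Subgroup (GL (Fin 2) (FiniteAdeleRing (𝓞 K) K))}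
    (hinv : ∀ u ∈ U₀, ∀ g, η (GLn.ofFinite 2 K u * g) = η g) (g₀ : mixedSpace K → ℝ)
    (u : GL (Fin 2) (FiniteAdeleRing (𝓞 K) K)) (hu : u ∈ U₀) (g : GL (Fin 2) (AdeleRing (𝓞 K) K)) :
    archUnipotentConv g₀ η (GLn.ofFinite 2 K u * g) = archUnipotentConv g₀ η g := by
  rw [archUnipotentConv_apply_gl, archUnipotentConv_apply_gl]
  refine integral_congr_ae (ae_of_all _ fun x => ?_)
  show g₀ x * η ((archUnipotentGL K x)⁻¹ * (GLn.ofFinite 2 K u * g)) =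
    g₀ x * η ((archUnipotentGL K x)⁻¹ * g)
  have hc : (archUnipotentGL K x)⁻¹ * GLn.ofFinite 2 K u = GLn.ofFinite 2 K u * (archUnipotentGL K x)⁻¹ := by
    rw [archUnipotentGL_eq, ← map_inv]
    exact (GLn.commute_ofInfinite_ofFinite _ u).eq
  rw [← mul_assoc, hc, mul_assoc, hinv u hu]

/-- The direction `y ↦ y E₁₂ = (0 y; 0 0)` of the unipotent line, a real linear map. [folklore] -/
def unipotentDirGL2 : mixedSpace K →ₗ[ℝ] Matrix (Fin 2) (Fin 2) (mixedSpace K) where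
  toFun y := Matrix.of ![![0, y], ![0, 0]]
  map_add' a b := by
    refine Matrix.ext fun i j => ?_
    fin_cases i <;> fin_cases j <;> simp
  map_smul' c a := by
    refine Matrix.ext fun i j => ?_
    fin_cases i <;> fin_cases j <;> simp

omit [NumberField K] in
/-- `n(y) = 1 + y E₁₂`. [folklore] -/
theorem coe_unipotentGL2_eq_one_add (y : mixedSpace K) :
    (((unipotentGL2 y : ↥(upperUnitriangular (Fin 2) (mixedSpace K))) : GL (Fin 2) (mixedSpace K)) :
        Matrix (Fin 2) (Fin 2) (mixedSpace K)) = 1 + unipotentDirGL2 y := by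
  rw [coe_unipotentGL2]
  refine Matrix.ext fun i j => ?_
  fin_cases i <;> fin_cases j <;> simp [unipotentDirGL2]

/-- **The unipotent line is smooth**: `y ↦ n(y) ∈ M_2(K_∞)` is `C^∞` (affine). [folklore] -/
theorem contDiff_coe_unipotentGL2 :
    ContDiff ℝ ∞ fun y : mixedSpace K =>
      (((unipotentGL2 y : ↥(upperUnitriangular (Fin 2) (mixedSpace K))) : GL (Fin 2) (mixedSpace K)) :
        Matrix (Fin 2) (Fin 2) (mixedSpace K)) := by
  have hL : Continuous (unipotentDirGL2 (K := K)) := LinearMap.continuous_of_finiteDimensional _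
  set L : mixedSpace K →L[ℝ] Matrix (Fin 2) (Fin 2) (mixedSpace K) := ⟨unipotentDirGL2, hL⟩ with hLdef
  have h : (fun y : mixedSpace K =>
      (((unipotentGL2 y : ↥(upperUnitriangular (Fin 2) (mixedSpace K))) : GL (Fin 2) (mixedSpace K)) :
        Matrix (Fin 2) (Fin 2) (mixedSpace K))) = fun y => 1 + L y := by
    funext y
    exact coe_unipotentGL2_eq_one_add y
  rw [h]
  exact contDiff_const.add L.contDiff

/-- `n(y)⁻¹ = n(-y)` in `GL_2`. [folklore] -/
theorem unipotentGL2_neg {R : Type*} [CommRing R] (y : R) :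
    unipotentGL2 (-y) = (unipotentGL2 y)⁻¹ := by
  rw [eq_inv_iff_mul_eq_one, ← unipotentGL2_add, neg_add_cancel, unipotentGL2_zero]

/-- The inverse of the adelic archimedean unipotent: `n((x,0))⁻¹ = n((-x,0))`. [folklore] -/
theorem archUnipotentGL_neg (x : mixedSpace K) :
    archUnipotentGL K (-x) = (archUnipotentGL K x)⁻¹ := by
  rw [archUnipotentGL_eq, archUnipotentGL_eq, unipotentGL2_neg, Subgroup.coe_inv, map_inv]

/-- **Rewriting the convolution integrand through the left archimedean slice**: for
`g ∈ GL_2(𝔸_K)` with archimedean component `c = g_∞`,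
`η(n((x,0))⁻¹ · g · (exp M, 1)) = leftArchSlice η g (n(-x) c exp(M) c⁻¹)`. [folklore] -/
theorem eta_archUnipotent_inv_mul_expSlice (g : GL (Fin 2) (AdeleRing (𝓞 K) K)) (x : mixedSpace K)
    (M : Matrix (Fin 2) (Fin 2) (mixedSpace K)) :
    η ((archUnipotentGL K x)⁻¹ * (g * GLn.ofInfinite 2 K (expGL M))) =
      leftArchSlice η g
        ((((unipotentGL2 (-x) : ↥(upperUnitriangular (Fin 2) (mixedSpace K))) : GL (Fin 2) (mixedSpace K)) :
            Matrix (Fin 2) (Fin 2) (mixedSpace K)) *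
          ((GLn.toMixed 2 K g : GL (Fin 2) (mixedSpace K)) : Matrix (Fin 2) (Fin 2) (mixedSpace K)) *
          NormedSpace.exp M *
          (((GLn.toMixed 2 K g)⁻¹ : GL (Fin 2) (mixedSpace K)) : Matrix (Fin 2) (Fin 2) (mixedSpace K))) := by
  set c : GL (Fin 2) (mixedSpace K) := GLn.toMixed 2 K g with hc
  set u : GL (Fin 2) (mixedSpace K) :=
    ((unipotentGL2 (-x) : ↥(upperUnitriangular (Fin 2) (mixedSpace K))) : GL (Fin 2) (mixedSpace K)) *
      c * expGL M * c⁻¹ with hu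
  have hmat : (u : Matrix (Fin 2) (Fin 2) (mixedSpace K)) =
      (((unipotentGL2 (-x) : ↥(upperUnitriangular (Fin 2) (mixedSpace K))) : GL (Fin 2) (mixedSpace K)) :
          Matrix (Fin 2) (Fin 2) (mixedSpace K)) *
        (c : Matrix (Fin 2) (Fin 2) (mixedSpace K)) * NormedSpace.exp M *
        ((c⁻¹ : GL (Fin 2) (mixedSpace K)) : Matrix (Fin 2) (Fin 2) (mixedSpace K)) := by
    simp only [hu, Units.val_mul, coe_expGL]
  rw [← hmat, leftArchSlice_coe]
  congr 1
  -- group identity in `GL_2(𝔸_K)`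
  have h1 : g * GLn.ofInfinite 2 K (expGL M) = GLn.ofInfinite 2 K (c * expGL M * c⁻¹) * g := by
    rw [← GLn.mul_ofInfinite_mul_inv, inv_mul_cancel_right]
  rw [h1, ← archUnipotentGL_neg, archUnipotentGL_eq, ← mul_assoc, ← map_mul, hu]
  congr 2
  simp only [mul_assoc]

/-- **The archimedean unipotent convolution of a test function by a smooth compactly supported
kernel is a test function.** [cite: JacquetShalikaAJM1981, §4] -/
theorem isTestFunctionGL_archUnipotentConv (hη : IsTestFunctionGL 2 K η) {g₀ : mixedSpace K → ℝ}
    (hg₀ : ContDiff ℝ ∞ g₀) (hg₀s : HasCompactSupport g₀) :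
    IsTestFunctionGL 2 K (archUnipotentConv g₀ η) := by
  refine isTestFunctionGL_of_contDiff_expSlice
    (continuous_archUnipotentConv hg₀.continuous hg₀s hη.continuous hη.hasCompactSupport)
    (hasCompactSupport_archUnipotentConv hg₀s hη.hasCompactSupport) (fun g => ?_) ?_
  · -- smoothness of the exponential slice by differentiation under the integral sign
    set c : GL (Fin 2) (mixedSpace K) := GLn.toMixed 2 K g with hc
    -- the smooth matrix `Ψ(M, x) = n(-x) c exp(M) c⁻¹`
    set Ψ : Matrix (Fin 2) (Fin 2) (mixedSpace K) × mixedSpace K → Matrix (Fin 2) (Fin 2) (mixedSpace K) :=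
      fun p => (((unipotentGL2 (-p.2) : ↥(upperUnitriangular (Fin 2) (mixedSpace K))) :
          GL (Fin 2) (mixedSpace K)) : Matrix (Fin 2) (Fin 2) (mixedSpace K)) *
        (c : Matrix (Fin 2) (Fin 2) (mixedSpace K)) * NormedSpace.exp p.1 *
        ((c⁻¹ : GL (Fin 2) (mixedSpace K)) : Matrix (Fin 2) (Fin 2) (mixedSpace K)) with hΨ
    have hexp : ContDiff ℝ ∞ (NormedSpace.exp : Matrix (Fin 2) (Fin 2) (mixedSpace K) →
        Matrix (Fin 2) (Fin 2) (mixedSpace K)) :=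
      contDiff_iff_contDiffAt.2 fun M => (NormedSpace.exp_analytic (𝕂 := ℝ) M).contDiffAt
    have hΨs : ContDiff ℝ ∞ Ψ :=
      (((contDiff_coe_unipotentGL2.comp (contDiff_neg.comp contDiff_snd)).mul contDiff_const).mul
        (hexp.comp contDiff_fst)).mul contDiff_const
    -- the smooth kernel `A(M, x) = η(n((x,0))⁻¹ g (exp M, 1))`
    set A : Matrix (Fin 2) (Fin 2) (mixedSpace K) × mixedSpace K → ℂ :=
      fun p => ((leftArchSlice η g (Ψ p) : ℝ) : ℂ) with hA
    have hAs : ContDiff ℝ ∞ A :=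
      Complex.ofRealCLM.contDiff.comp ((hη.contDiff_leftArchSlice g).comp hΨs)
    have hAeq : ∀ (M : Matrix (Fin 2) (Fin 2) (mixedSpace K)) (x : mixedSpace K),
        A (M, x) = ((η ((archUnipotentGL K x)⁻¹ * (g * GLn.ofInfinite 2 K (expGL M))) : ℝ) : ℂ) := by
      intro M x
      simp only [hA, hΨ]
      rw [eta_archUnipotent_inv_mul_expSlice (η := η)]
    -- a ball containing the support of the kernel
    obtain ⟨R, hR⟩ := (hg₀s.isCompact.isBounded).subset_closedBall (0 : mixedSpace K)
    set ν : Measure (mixedSpace K) := volume.restrict (Metric.closedBall (0 : mixedSpace K) R) with hν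
    have hmR : ∀ᵐ x ∂ν, ‖(id x : mixedSpace K)‖ ≤ R := by
      refine (ae_restrict_iff' Metric.isClosed_closedBall.measurableSet).2 (ae_of_all _ fun x hx => ?_)
      simpa only [id, Metric.mem_closedBall, dist_zero_right] using hx
    have hF : Integrable (fun x => (g₀ x : ℂ)) ν :=
      ((hg₀.continuous.integrable_of_hasCompactSupport hg₀s).ofReal).restrict
    have hsmooth := Literature.Analysis.Calculus.contDiff_integral_kernel_mul hAs
      (aestronglyMeasurable_id) hmR hF
    -- identify the smooth parametric integral with the exponential slice of the convolution
    have hident : (fun M : Matrix (Fin 2) (Fin 2) (mixedSpace K) =>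
        archUnipotentConv g₀ η (g * GLn.ofInfinite 2 K (expGL M))) =
        fun M => Complex.re (∫ x, A (M, id x) * (g₀ x : ℂ) ∂ν) := by
      funext M
      have h1 : ∫ x, A (M, id x) * (g₀ x : ℂ) ∂ν =
          ((∫ x, g₀ x * η ((archUnipotentGL K x)⁻¹ * (g * GLn.ofInfinite 2 K (expGL M))) ∂ν : ℝ) : ℂ) := by
        rw [← integral_complex_ofReal]
        refine integral_congr_ae (ae_of_all _ fun x => ?_)
        simp only [id, hAeq, Complex.ofReal_mul, mul_comm]
      have h2 : ∫ x, g₀ x * η ((archUnipotentGL K x)⁻¹ * (g * GLn.ofInfinite 2 K (expGL M))) ∂ν =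
          ∫ x, g₀ x * η ((archUnipotentGL K x)⁻¹ * (g * GLn.ofInfinite 2 K (expGL M))) := by
        refine setIntegral_eq_integral_of_forall_compl_eq_zero fun x hx => ?_
        have hx' : x ∉ tsupport g₀ := fun h => hx (hR h)
        rw [image_eq_zero_of_notMem_tsupport hx', zero_mul]
      rw [h1, Complex.ofReal_re, h2]
      rfl
    rw [hident]
    exact Complex.reCLM.contDiff.comp hsmooth
  · obtain ⟨U, hU, hinv⟩ := hη.exists_level
    exact ⟨U, hU, fun u hu g => archUnipotentConv_mul_right (U := (U : Set _)) hinv g₀ u hu g⟩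

end GL2

end Literature.NumberTheory.Automorphic
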